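import Summits.SmoothPoincare4.SmoothPoincare4.Theses.CartanHadamardSwindle
import Literature.Topology.FourManifolds.CorkPresentationHomotopySphere
import Literature.Geometry.Lorentzian.Isometry
import HarnessLib

/-!
# Line `birth` — BC3 skeleton for the crux `FarrellJonesFour` (stmt-SmoothPoincare4-8096)

Route `CartanHadamardSwindle` (route-SmoothPoincare4-CartanHadamardSwindle), crux #3 `FarrellJonesFour`
(rank 3, open-problem): for every closed connected hyperbolic 4-manifold `X` and every homotopy 4-sphere
`Σ` some finite smooth cover `Z → X` has a closed connected `P` which is a connected sum `Z # Σ`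
(`IsConnectedSum (𝓡 4) (𝓡 4) (𝓡 4) Z Σ P`) and carries a Riemannian metric with a Levi-Civita
connection of non-positive sectional curvature (`curvatureForm cov x v w w v ≤ 0`, Lee's sign).

Skeleton registrar (planner one-shot `skel-stmt-SmoothPoincare4-8096`, 2026-08-17).  THE LINE is the
route header's own two-layer plan (a) for this node — "FarrellJonesFour ⇐ CorkTwistCovers → CorkFlattening:
a Farrell–Jones neck along a CORK boundary instead of a geodesic sphere" — typed over the tree's gluing
vocabulary (`BoundaryData`, `IsBoundaryGluing`; Hirsch Ch. 8) and cut into three named statements,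
exactly one of which carries the open geometric content:

* `stub_corkPresentation` — TOPOLOGY (XL literature leaf; the stub of the same name registered on
  `WeylBudget.CorkRegluablePsc` plus the one clause `∂C` connected (hence nonempty), so one proof serves both cruxes): every
  homotopy 4-sphere is a cork twist of the standard `S⁴` by an INVOLUTION: `S⁴ = C ∪_φ W`, `Σ = C ∪_(φ∘τ) W`
  with `C` compact contractible with CONNECTED NONEMPTY boundary, `W` compact, `τ ∈ Diff(∂C)` involutive.  Minus
  `Function.Involutive τ ∧ ConnectedSpace bC.carrier` this is the conclusion of the tree's PROVED packaging
  `Literature.Topology.FourManifolds.HomotopySphere.exists_corkPresentation_of_facts`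
  (from the named facts `Θ₄ = 0` = `isHCobordant_sphere_of_homotopySphere_four` and
  `Matveyev1996_decomposition`); the involution refinement is the printed cork theorem (Akbulut–Yasui 2008,
  Thm. 1.1, arXiv:0806.3010, crediting Matveyev 1996, Curtis–Freedman–Hsiang–Stong 1996, Akbulut–Matveyev
  1998); `∂C` is connected and nonempty because it is an integral homology 3-sphere (Lefschetz duality on
  the compact contractible `C`; printed: Matveyev's `Σ = ∂W₁` is a homology sphere) — recorded so that the
  geometric stubs never meet the junk configuration `∂C = ∅, W = ∅` and get `Z ∖ kC(C)` connected for free.  The involution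
  is what the geometric stub consumes (an isometric involutive germ along `∂C`).
* `stub_corkFlattening` — THE BET (the crux's geometric heart = the route's "CorkFlattening", stated with
  NO homotopy sphere in sight; open): for every closed connected hyperbolic 4-manifold `(X, gX)`, every
  compact contractible `C` with boundary datum `bC`, every involution `τ` of `∂C` and every smooth
  embedding `jC : C ↪ S⁴` there are a finite smooth cover `c : Z → X` (covering, surjective, local
  diffeomorphism; `Z` compact connected), a point `q ∉ jC(C)` and a smooth embedding `e : S⁴ ∖ {q} ↪ Z`
  extending `kC : C ↪ Z` (`e ∘ jC = kC`: the cork sits INSIDE A BALL of `Z`, through its given position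
  in `S⁴`), a Riemannian metric `g` on `Z` with a Levi-Civita connection `cov` of non-positive sectional
  curvature, an open `U ⊇ kC(∂C)` and `T : Z → Z`, smooth involutive and `g`-isometric on `U`, preserving
  the two sides (`T x ∈ kC(C) ↔ x ∈ kC(C)` on `U`) and restricting to `τ` on the cork boundary
  (`T ∘ kC ∘ incl = kC ∘ incl ∘ τ`).  Germ form ⟸ jet form of the route text ("metrics `g_C`, `g_V` on
  `C`, `Z ∖ C̊`, both sec ≤ 0, whose boundary ∞-jets agree AND are τ-invariant"): averaging a τ-invariant
  jet in Fermi coordinates yields an honest isometric involution `τ × id`.  By the planner's lemma (iii)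
  of the route header `g` must have VARIABLE curvature near `kC(∂C)` for a genuine cork (a local isometry
  of `H⁴` extends globally and would extend `τ` over `C`); for `C = B⁴` and `τ` orthogonal the hyperbolic
  metric of a cover with a large embedded ball already works (Farrell–Jones' template; residual finiteness).
* `stub_isometricCorkSum` — DIFFERENTIAL TOPOLOGY + LOCALITY OF CURVATURE (L, provable in principle with
  the tree's open-gluing tools `IsOpenGluing`, `OpenGluingIsManifold`, gluing uniqueness
  `nonempty_diffeomorph_of_isBoundaryGluing_holds`, Levi-Civita naturality): given the splitting
  `S⁴ = C ∪_φ W`, ANY `Q = C ∪_(φ∘τ) W`, and the data of the previous stub on a closed connected `Z`,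
  cut `(Z, g)` along `kC(∂C)` and reglue by the germ isometry `T`: the open gluing
  `P := (kC(C) ∪ U) ⊔ (Z ∖ kC(C)) / (x ∼ T x, x ∈ U ∖ kC(C))` is a closed connected smooth 4-manifold
  carrying `γ := g ⊔ g` (compatible since `T^* g = g`), hence Levi-Civita with sec ≤ 0, and — because the
  regluing is supported in the ball `e(S⁴ ∖ {q})` and there it is the regluing that turns `S⁴` into
  `C ∪_(φ∘τ) W ≅ Q` — `P` is a Kervaire–Milnor connected sum `Z # Q` (`IsConnectedSum`).

Composition (`farrellJonesFour_of_stubSigs`, sorry-free, standard axioms; `FarrellJonesFour_of` feeds it the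
three stubs and concludes the crux BY NAME): given `X, gX, Σ`, present `Σ` (stub 1) and destructure
`S⁴ = C ∪_φ W` into `jC, jW`; flatten (stub 2) to get `Z, c, q, e, kC, g, cov, U, T`; reglue and identify
(stub 3 with `Q := Σ.carrier`) to get `P ≅ Z # Σ` with its sec ≤ 0 metric; repackage into the crux's
existential.  Pure logic.

Honest sizes: stub 1 XL (cork theorem; shared leaf), stub 2 = the crux's open content (with stubs 1, 3 it
implies the crux; it is NOT implied by the crux, which does not ask the metric on `Z # Σ` to come from a
τ-symmetric metric on `Z`), stub 3 L.  `sorry` occurs ONLY in the three `stub_*` theorems.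
Disproof used: none (no `Cruxes/FarrellJonesFour/Disproof.lean` exists at registration;
`ledger negatives --problem SmoothPoincare4` = 0 refuted statements, so no stub is an instance of a refuted
statement).
-/

noncomputable section

-- `Summit.<Summit>.<Problem>`: for the single-conjunct summit the duplicate component is mandated.
set_option linter.dupNamespace false
set_option linter.unusedVariables false

open scoped Manifold ContDiff Topology

namespace Summit.SmoothPoincare4.SmoothPoincare4.Cruxes.FarrellJonesFour.Birth

/-! ## The three registered stubs -/

/-- **Stub 1 — cork presentation of homotopy 4-spheres by an involution (topology, XL leaf).**
Every homotopy 4-sphere `Σ` is `C ∪_(φ∘τ) W` where `S⁴ = C ∪_φ W`, `C` compact contractible, `W` compact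
(smooth 4-manifolds with boundary, Hausdorff, second countable), `φ : ∂C ≅ ∂W`, and `τ : ∂C ≅ ∂C` an
INVOLUTION, and `∂C` is CONNECTED (hence nonempty).  Minus `Function.Involutive τ ∧ ConnectedSpace bC.carrier`
this is verbatim the conclusion of the tree's proved `HomotopySphere.exists_corkPresentation_of_facts`
(`Θ₄ = 0` + Matveyev's two-piece cork theorem); the involution clause is the printed refinement
(Akbulut–Yasui 2008 Thm. 1.1, arXiv:0806.3010); `ConnectedSpace bC.carrier` holds because the boundary of a
compact contractible 4-manifold is an integral homology 3-sphere (Lefschetz duality; Matveyev 1996: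
"`Σ = ∂W₁ = ∂W₂ = ∂M`" a homology sphere).  Up to that clause it is the stub `stub_corkPresentation`
registered on `WeylBudget.CorkRegluablePsc` (shared leaf).
Sources: CurtisFreedmanHsiangStong1996 (Theorem), Matveyev1996 (Theorem), AkbulutMatveyev1998,
arXiv:0806.3010 (Thm. 1.1), KervaireMilnorAnnals1963 (Θ₄ = 0). -/
theorem stub_corkPresentation :
    ∀ S : Literature.Topology.FourManifolds.HomotopySphere 4, ∃ (C : Type) (_ : TopologicalSpace C) (_ : T2Space C)
    (_ : SecondCountableTopology C) (_ : ChartedSpace (EuclideanHalfSpace 4) C)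
    (_ : IsManifold (𝓡∂ 4) ∞ C) (_ : CompactSpace C) (_ : ContractibleSpace C)
    (bC : Literature.Topology.FourManifolds.BoundaryData (𝓡∂ 4) C (𝓡 3))
    (W : Type) (_ : TopologicalSpace W) (_ : T2Space W) (_ : SecondCountableTopology W)
    (_ : ChartedSpace (EuclideanHalfSpace 4) W) (_ : IsManifold (𝓡∂ 4) ∞ W) (_ : CompactSpace W)
    (bW : Literature.Topology.FourManifolds.BoundaryData (𝓡∂ 4) W (𝓡 3))
    (φ : bC.carrier ≃ₘ⟮𝓡 3, 𝓡 3⟯ bW.carrier) (τ : bC.carrier ≃ₘ⟮𝓡 3, 𝓡 3⟯ bC.carrier),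
    Function.Involutive τ ∧ ConnectedSpace bC.carrier ∧
    Literature.Topology.FourManifolds.IsBoundaryGluing bC bW φ (𝓡 4) (Metric.sphere (0 : EuclideanSpace ℝ (Fin 5)) 1) ∧
    Literature.Topology.FourManifolds.IsBoundaryGluing bC bW (τ.trans φ) (𝓡 4) S.carrier := by
  sorry

/-- **Stub 2 — cork flattening: a τ-symmetric sec ≤ 0 germ along an embedded cork boundary in a finite
cover of a hyperbolic 4-manifold (THE BET of the crux; the route's "CorkFlattening").**
For every closed connected hyperbolic `(X, gX)` (Riemannian, constant sectional curvature `-1`), every compact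
contractible `C` with boundary datum `bC` (`∂C` connected, nonempty), every involution `τ` of `∂C` and every smooth
embedding `jC : C ↪ S⁴`: a finite smooth cover `c : Z → X` (covering map, surjective, local diffeomorphism; `Z` compact
connected), a point `q` off `jC(C)`, the open set `O = S⁴ ∖ {q}` and a smooth embedding `e : O ↪ Z` with
`e ∘ jC = kC` (`kC : C ↪ Z` a smooth embedding), a Riemannian `g` on `Z` with Levi-Civita connection `cov`
and `Rm(v, w, w, v) ≤ 0`, an open `U ⊇ kC(∂C)` and `T : Z → Z` smooth on `U` with `T(U) ⊆ U`, `T ∘ T = id`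
on `U`, side-preserving on `U` (`T x ∈ kC(C) ↔ x ∈ kC(C)`), `T ∘ kC ∘ incl = kC ∘ incl ∘ τ`, `T^* g = g` on
`U`.
Why plausibly true / why it might fail: for `C = B⁴` with `τ` orthogonal it holds with the hyperbolic metric
of a cover containing a large embedded ball (Farrell–Jones' template: residual finiteness of `π₁ X` + an
`O(4)`-invariant germ along a geodesic sphere); for a genuine cork the germ cannot be locally symmetric (a
local isometry of `H⁴` extends to a global one and would extend `τ` over `C`, route header (iii)), so the
stub asks for a VARIABLE-curvature sec ≤ 0 metric on a deep cover whose germ along a non-convex homology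
sphere `kC(∂C)` admits the isometric involution — a two-sided symmetric fill-in problem which may be
obstructed, and which is false as soon as some homotopy 4-sphere is not a unit (then the crux dies too).
Size: open.  Sources: doi:10.1090/s0894-0347-1989-1002632-2 (Farrell–Jones 1989), arXiv:1406.1739
(Ontaneda, §0), doi:10.4310/sdg.2006.v11.n1.a11 (FJO survey, Thm. 7), arXiv:0806.3010, Lee2018 (Ch. 12). -/
theorem stub_corkFlattening :
    ∀ (X : Type) [TopologicalSpace X] [T2Space X] [SecondCountableTopology X]
    [ChartedSpace (EuclideanSpace ℝ (Fin 4)) X] [IsManifold (𝓡 4) ∞ X] [CompactSpace X] [ConnectedSpace X]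
    (gX : Literature.Geometry.Lorentzian.PseudoRiemannianMetric (𝓡 4) ∞ (EuclideanSpace ℝ (Fin 4)) (TangentSpace (𝓡 4) : X → Type _)),
    gX.IsRiemannian → gX.HasConstantSectionalCurvature (-1) →
    ∀ (C : Type) [TopologicalSpace C] [T2Space C] [SecondCountableTopology C]
    [ChartedSpace (EuclideanHalfSpace 4) C] [IsManifold (𝓡∂ 4) ∞ C] [CompactSpace C] [ContractibleSpace C]
    (bC : Literature.Topology.FourManifolds.BoundaryData (𝓡∂ 4) C (𝓡 3))
    (τ : bC.carrier ≃ₘ⟮𝓡 3, 𝓡 3⟯ bC.carrier)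
    (jC : C → (Metric.sphere (0 : EuclideanSpace ℝ (Fin 5)) 1)),
    Function.Involutive τ → ConnectedSpace bC.carrier → Manifold.IsSmoothEmbedding (𝓡∂ 4) (𝓡 4) ∞ jC →
    ∃ (Z : Type) (_ : TopologicalSpace Z) (_ : T2Space Z) (_ : SecondCountableTopology Z)
    (_ : ChartedSpace (EuclideanSpace ℝ (Fin 4)) Z) (_ : IsManifold (𝓡 4) ∞ Z) (_ : CompactSpace Z)
    (_ : ConnectedSpace Z)
    (c : Z → X) (q : (Metric.sphere (0 : EuclideanSpace ℝ (Fin 5)) 1))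
    (O : TopologicalSpace.Opens (Metric.sphere (0 : EuclideanSpace ℝ (Fin 5)) 1)) (e : O → Z) (kC : C → Z)
    (g : Literature.Geometry.Lorentzian.PseudoRiemannianMetric (𝓡 4) ∞ (EuclideanSpace ℝ (Fin 4)) (TangentSpace (𝓡 4) : Z → Type _))
    (cov : CovariantDerivative (𝓡 4) (EuclideanSpace ℝ (Fin 4)) (TangentSpace (𝓡 4) : Z → Type _))
    (U : Set Z) (T : Z → Z),
    (IsCoveringMap c ∧ Function.Surjective c ∧ IsLocalDiffeomorph (𝓡 4) (𝓡 4) ∞ c) ∧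
    (O : Set (Metric.sphere (0 : EuclideanSpace ℝ (Fin 5)) 1)) = {q}ᶜ ∧ (∀ a, jC a ∈ O) ∧
    Manifold.IsSmoothEmbedding (𝓡 4) (𝓡 4) ∞ e ∧ (∀ (x : O) (a : C), x.1 = jC a → e x = kC a) ∧
    Manifold.IsSmoothEmbedding (𝓡∂ 4) (𝓡 4) ∞ kC ∧
    g.IsRiemannian ∧ g.IsLeviCivita cov ∧
    (∀ (x : Z) (v w : TangentSpace (𝓡 4) x), g.curvatureForm cov x v w w v ≤ 0) ∧
    IsOpen U ∧ (∀ z, kC (bC.incl z) ∈ U) ∧ ContMDiffOn (𝓡 4) (𝓡 4) ∞ T U ∧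
    (∀ x ∈ U, T x ∈ U) ∧ (∀ x ∈ U, T (T x) = x) ∧
    (∀ x ∈ U, (T x ∈ Set.range kC ↔ x ∈ Set.range kC)) ∧
    (∀ z, T (kC (bC.incl z)) = kC (bC.incl (τ z))) ∧
    (∀ x ∈ U, Literature.Geometry.Lorentzian.pullbackBilin (I := 𝓡 4) (I' := 𝓡 4) T g.val x = g.val x) := by
  sorry

/-- **Stub 3 — isometric cork regluing inside a ball is a connected sum with the twisted sphere, and keeps
sec ≤ 0 (differential topology + locality of curvature, L).**
Given the splitting `S⁴ = C ∪_φ W` (piece embeddings `jC, jW`, `τ` an involution of `∂C`), ANY smooth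
4-manifold `Q` which is the gluing `C ∪_(φ∘τ) W`, a closed connected `Z` with `e : S⁴ ∖ {q} ↪ Z` extending
`kC = e ∘ jC`, a Riemannian `g` on `Z` (Levi-Civita `cov`, `Rm(v,w,w,v) ≤ 0`) and a germ `(U, T)` along
`kC(∂C)` as in Stub 2: there is a closed connected smooth `P` which is a connected sum `Z # Q`
(`IsConnectedSum (𝓡 4) (𝓡 4) (𝓡 4) Z Q P`, Kervaire–Milnor) carrying a Riemannian `γ` with a Levi-Civita
connection of non-positive sectional curvature.  Proof sketch: `P :=` the OPEN gluing of `kC(C) ∪ U` and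
`Z ∖ kC(C)` along `T|(U ∖ kC C)` (Hausdorff because `T(kC ∂C) = kC ∂C ⊆ kC C` excludes seam limits of the
graph; compact/connected from `Z`), `γ := g ⊔ g` and `cov' := cov ⊔ cov` (compatible because `T^* g = g` and
isometries preserve the Levi-Civita connection), so `Rm_γ ≤ 0` pointwise; the modification is supported in
the compact `e(jC C ∪ Ū') ⊂ e(S⁴ ∖ {q}) ≅ ℝ⁴`, where it is the regluing that turns `S⁴` into
`C ∪_(φ∘τ) W` (piece embeddings `[jC]`, `[jW]` resp. `[T₀ ∘ jW]` near `∂W`, consistent as `τ² = id`), which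
is `≅ Q` by gluing uniqueness; hence `P = (Z ∖ ball°) ∪_(S³) (Q ∖ disc°)`, a Kervaire–Milnor sum `Z # Q`.
Sources: HirschDT1976 (Ch. 8 §2 Thm. 2.1), BrockerJanich1982 (§13), KervaireMilnorAnnals1963 (§2,
Lemma 2.1), Kosinski1993 (VI.1), ONeill1983 (Ch. 3, pp. 58, 90–91); tree: `IsOpenGluing`,
`OpenGluingIsManifold`, `nonempty_diffeomorph_of_isBoundaryGluing_holds`, `pullbackBilin_comp`. -/
theorem stub_isometricCorkSum :
    ∀ (C : Type) [TopologicalSpace C] [T2Space C] [SecondCountableTopology C]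
    [ChartedSpace (EuclideanHalfSpace 4) C] [IsManifold (𝓡∂ 4) ∞ C] [CompactSpace C] [ContractibleSpace C]
    (bC : Literature.Topology.FourManifolds.BoundaryData (𝓡∂ 4) C (𝓡 3))
    (W : Type) [TopologicalSpace W] [T2Space W] [SecondCountableTopology W]
    [ChartedSpace (EuclideanHalfSpace 4) W] [IsManifold (𝓡∂ 4) ∞ W] [CompactSpace W]
    (bW : Literature.Topology.FourManifolds.BoundaryData (𝓡∂ 4) W (𝓡 3))
    (φ : bC.carrier ≃ₘ⟮𝓡 3, 𝓡 3⟯ bW.carrier) (τ : bC.carrier ≃ₘ⟮𝓡 3, 𝓡 3⟯ bC.carrier)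
    (jC : C → (Metric.sphere (0 : EuclideanSpace ℝ (Fin 5)) 1))
    (jW : W → (Metric.sphere (0 : EuclideanSpace ℝ (Fin 5)) 1)),
    Function.Involutive τ → ConnectedSpace bC.carrier →
    Manifold.IsSmoothEmbedding (𝓡∂ 4) (𝓡 4) ∞ jC → Manifold.IsSmoothEmbedding (𝓡∂ 4) (𝓡 4) ∞ jW →
    Set.range jC ∪ Set.range jW = Set.univ →
    (∀ a b, jC a = jW b ↔ ∃ z, a = bC.incl z ∧ b = bW.incl (φ z)) →
    ∀ (Q : Type) [TopologicalSpace Q] [T2Space Q] [SecondCountableTopology Q]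
    [ChartedSpace (EuclideanSpace ℝ (Fin 4)) Q] [IsManifold (𝓡 4) ∞ Q],
    Literature.Topology.FourManifolds.IsBoundaryGluing bC bW (τ.trans φ) (𝓡 4) Q →
    ∀ (Z : Type) [TopologicalSpace Z] [T2Space Z] [SecondCountableTopology Z]
    [ChartedSpace (EuclideanSpace ℝ (Fin 4)) Z] [IsManifold (𝓡 4) ∞ Z] [CompactSpace Z] [ConnectedSpace Z]
    (q : (Metric.sphere (0 : EuclideanSpace ℝ (Fin 5)) 1))
    (O : TopologicalSpace.Opens (Metric.sphere (0 : EuclideanSpace ℝ (Fin 5)) 1)) (e : O → Z) (kC : C → Z)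
    (g : Literature.Geometry.Lorentzian.PseudoRiemannianMetric (𝓡 4) ∞ (EuclideanSpace ℝ (Fin 4)) (TangentSpace (𝓡 4) : Z → Type _))
    (cov : CovariantDerivative (𝓡 4) (EuclideanSpace ℝ (Fin 4)) (TangentSpace (𝓡 4) : Z → Type _))
    (U : Set Z) (T : Z → Z),
    (O : Set (Metric.sphere (0 : EuclideanSpace ℝ (Fin 5)) 1)) = {q}ᶜ → (∀ a, jC a ∈ O) →
    Manifold.IsSmoothEmbedding (𝓡 4) (𝓡 4) ∞ e → (∀ (x : O) (a : C), x.1 = jC a → e x = kC a) →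
    Manifold.IsSmoothEmbedding (𝓡∂ 4) (𝓡 4) ∞ kC →
    g.IsRiemannian → g.IsLeviCivita cov →
    (∀ (x : Z) (v w : TangentSpace (𝓡 4) x), g.curvatureForm cov x v w w v ≤ 0) →
    IsOpen U → (∀ z, kC (bC.incl z) ∈ U) → ContMDiffOn (𝓡 4) (𝓡 4) ∞ T U →
    (∀ x ∈ U, T x ∈ U) → (∀ x ∈ U, T (T x) = x) →
    (∀ x ∈ U, (T x ∈ Set.range kC ↔ x ∈ Set.range kC)) →
    (∀ z, T (kC (bC.incl z)) = kC (bC.incl (τ z))) →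
    (∀ x ∈ U, Literature.Geometry.Lorentzian.pullbackBilin (I := 𝓡 4) (I' := 𝓡 4) T g.val x = g.val x) →
    ∃ (P : Type) (_ : TopologicalSpace P) (_ : T2Space P) (_ : SecondCountableTopology P)
    (_ : ChartedSpace (EuclideanSpace ℝ (Fin 4)) P) (_ : IsManifold (𝓡 4) ∞ P) (_ : CompactSpace P)
    (_ : ConnectedSpace P),
    Literature.Topology.FourManifolds.IsConnectedSum (𝓡 4) (𝓡 4) (𝓡 4) Z Q P ∧
    ∃ (γ : Literature.Geometry.Lorentzian.PseudoRiemannianMetric (𝓡 4) ∞ (EuclideanSpace ℝ (Fin 4)) (TangentSpace (𝓡 4) : P → Type _))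
    (cov' : CovariantDerivative (𝓡 4) (EuclideanSpace ℝ (Fin 4)) (TangentSpace (𝓡 4) : P → Type _)),
    γ.IsRiemannian ∧ γ.IsLeviCivita cov' ∧
    ∀ (x : P) (v w : TangentSpace (𝓡 4) x), γ.curvatureForm cov' x v w w v ≤ 0 := by
  sorry

/-! ## The composition (sorry-free): the three statements imply the crux -/

/-- **The three stub statements imply `FarrellJonesFour`** — the real assembly of the line, in hypothesis
form (`h1` = Stub 1, `h2` = Stub 2, `h3` = Stub 3; the conclusion is the crux's body verbatim).  Pure logic:
present `Σ` as `C ∪_(φ∘τ) W` with `S⁴ = C ∪_φ W` (h1), destructure the `S⁴`-gluing into `jC, jW`, flatten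
along the embedded cork in a finite cover `Z` of `X` (h2), reglue isometrically and identify the result with
`Z # Σ` (h3 with `Q := Σ.carrier`). [folklore] -/
theorem farrellJonesFour_of_stubSigs
    (h1 : ∀ S : Literature.Topology.FourManifolds.HomotopySphere 4, ∃ (C : Type) (_ : TopologicalSpace C) (_ : T2Space C)
      (_ : SecondCountableTopology C) (_ : ChartedSpace (EuclideanHalfSpace 4) C)
      (_ : IsManifold (𝓡∂ 4) ∞ C) (_ : CompactSpace C) (_ : ContractibleSpace C)
      (bC : Literature.Topology.FourManifolds.BoundaryData (𝓡∂ 4) C (𝓡 3))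
      (W : Type) (_ : TopologicalSpace W) (_ : T2Space W) (_ : SecondCountableTopology W)
      (_ : ChartedSpace (EuclideanHalfSpace 4) W) (_ : IsManifold (𝓡∂ 4) ∞ W) (_ : CompactSpace W)
      (bW : Literature.Topology.FourManifolds.BoundaryData (𝓡∂ 4) W (𝓡 3))
      (φ : bC.carrier ≃ₘ⟮𝓡 3, 𝓡 3⟯ bW.carrier) (τ : bC.carrier ≃ₘ⟮𝓡 3, 𝓡 3⟯ bC.carrier),
      Function.Involutive τ ∧ ConnectedSpace bC.carrier ∧
      Literature.Topology.FourManifolds.IsBoundaryGluing bC bW φ (𝓡 4) (Metric.sphere (0 : EuclideanSpace ℝ (Fin 5)) 1) ∧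
      Literature.Topology.FourManifolds.IsBoundaryGluing bC bW (τ.trans φ) (𝓡 4) S.carrier)
    (h2 : ∀ (X : Type) [TopologicalSpace X] [T2Space X] [SecondCountableTopology X]
      [ChartedSpace (EuclideanSpace ℝ (Fin 4)) X] [IsManifold (𝓡 4) ∞ X] [CompactSpace X] [ConnectedSpace X]
      (gX : Literature.Geometry.Lorentzian.PseudoRiemannianMetric (𝓡 4) ∞ (EuclideanSpace ℝ (Fin 4)) (TangentSpace (𝓡 4) : X → Type _)),
      gX.IsRiemannian → gX.HasConstantSectionalCurvature (-1) →
      ∀ (C : Type) [TopologicalSpace C] [T2Space C] [SecondCountableTopology C]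
      [ChartedSpace (EuclideanHalfSpace 4) C] [IsManifold (𝓡∂ 4) ∞ C] [CompactSpace C] [ContractibleSpace C]
      (bC : Literature.Topology.FourManifolds.BoundaryData (𝓡∂ 4) C (𝓡 3))
      (τ : bC.carrier ≃ₘ⟮𝓡 3, 𝓡 3⟯ bC.carrier)
      (jC : C → (Metric.sphere (0 : EuclideanSpace ℝ (Fin 5)) 1)),
      Function.Involutive τ → ConnectedSpace bC.carrier → Manifold.IsSmoothEmbedding (𝓡∂ 4) (𝓡 4) ∞ jC →
      ∃ (Z : Type) (_ : TopologicalSpace Z) (_ : T2Space Z) (_ : SecondCountableTopology Z)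
      (_ : ChartedSpace (EuclideanSpace ℝ (Fin 4)) Z) (_ : IsManifold (𝓡 4) ∞ Z) (_ : CompactSpace Z)
      (_ : ConnectedSpace Z)
      (c : Z → X) (q : (Metric.sphere (0 : EuclideanSpace ℝ (Fin 5)) 1))
      (O : TopologicalSpace.Opens (Metric.sphere (0 : EuclideanSpace ℝ (Fin 5)) 1)) (e : O → Z) (kC : C → Z)
      (g : Literature.Geometry.Lorentzian.PseudoRiemannianMetric (𝓡 4) ∞ (EuclideanSpace ℝ (Fin 4)) (TangentSpace (𝓡 4) : Z → Type _))
      (cov : CovariantDerivative (𝓡 4) (EuclideanSpace ℝ (Fin 4)) (TangentSpace (𝓡 4) : Z → Type _))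
      (U : Set Z) (T : Z → Z),
      (IsCoveringMap c ∧ Function.Surjective c ∧ IsLocalDiffeomorph (𝓡 4) (𝓡 4) ∞ c) ∧
      (O : Set (Metric.sphere (0 : EuclideanSpace ℝ (Fin 5)) 1)) = {q}ᶜ ∧ (∀ a, jC a ∈ O) ∧
      Manifold.IsSmoothEmbedding (𝓡 4) (𝓡 4) ∞ e ∧ (∀ (x : O) (a : C), x.1 = jC a → e x = kC a) ∧
      Manifold.IsSmoothEmbedding (𝓡∂ 4) (𝓡 4) ∞ kC ∧
      g.IsRiemannian ∧ g.IsLeviCivita cov ∧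
      (∀ (x : Z) (v w : TangentSpace (𝓡 4) x), g.curvatureForm cov x v w w v ≤ 0) ∧
      IsOpen U ∧ (∀ z, kC (bC.incl z) ∈ U) ∧ ContMDiffOn (𝓡 4) (𝓡 4) ∞ T U ∧
      (∀ x ∈ U, T x ∈ U) ∧ (∀ x ∈ U, T (T x) = x) ∧
      (∀ x ∈ U, (T x ∈ Set.range kC ↔ x ∈ Set.range kC)) ∧
      (∀ z, T (kC (bC.incl z)) = kC (bC.incl (τ z))) ∧
      (∀ x ∈ U, Literature.Geometry.Lorentzian.pullbackBilin (I := 𝓡 4) (I' := 𝓡 4) T g.val x = g.val x))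
    (h3 : ∀ (C : Type) [TopologicalSpace C] [T2Space C] [SecondCountableTopology C]
      [ChartedSpace (EuclideanHalfSpace 4) C] [IsManifold (𝓡∂ 4) ∞ C] [CompactSpace C] [ContractibleSpace C]
      (bC : Literature.Topology.FourManifolds.BoundaryData (𝓡∂ 4) C (𝓡 3))
      (W : Type) [TopologicalSpace W] [T2Space W] [SecondCountableTopology W]
      [ChartedSpace (EuclideanHalfSpace 4) W] [IsManifold (𝓡∂ 4) ∞ W] [CompactSpace W]
      (bW : Literature.Topology.FourManifolds.BoundaryData (𝓡∂ 4) W (𝓡 3))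
      (φ : bC.carrier ≃ₘ⟮𝓡 3, 𝓡 3⟯ bW.carrier) (τ : bC.carrier ≃ₘ⟮𝓡 3, 𝓡 3⟯ bC.carrier)
      (jC : C → (Metric.sphere (0 : EuclideanSpace ℝ (Fin 5)) 1))
      (jW : W → (Metric.sphere (0 : EuclideanSpace ℝ (Fin 5)) 1)),
      Function.Involutive τ → ConnectedSpace bC.carrier →
      Manifold.IsSmoothEmbedding (𝓡∂ 4) (𝓡 4) ∞ jC → Manifold.IsSmoothEmbedding (𝓡∂ 4) (𝓡 4) ∞ jW →
      Set.range jC ∪ Set.range jW = Set.univ →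
      (∀ a b, jC a = jW b ↔ ∃ z, a = bC.incl z ∧ b = bW.incl (φ z)) →
      ∀ (Q : Type) [TopologicalSpace Q] [T2Space Q] [SecondCountableTopology Q]
      [ChartedSpace (EuclideanSpace ℝ (Fin 4)) Q] [IsManifold (𝓡 4) ∞ Q],
      Literature.Topology.FourManifolds.IsBoundaryGluing bC bW (τ.trans φ) (𝓡 4) Q →
      ∀ (Z : Type) [TopologicalSpace Z] [T2Space Z] [SecondCountableTopology Z]
      [ChartedSpace (EuclideanSpace ℝ (Fin 4)) Z] [IsManifold (𝓡 4) ∞ Z] [CompactSpace Z] [ConnectedSpace Z]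
      (q : (Metric.sphere (0 : EuclideanSpace ℝ (Fin 5)) 1))
      (O : TopologicalSpace.Opens (Metric.sphere (0 : EuclideanSpace ℝ (Fin 5)) 1)) (e : O → Z) (kC : C → Z)
      (g : Literature.Geometry.Lorentzian.PseudoRiemannianMetric (𝓡 4) ∞ (EuclideanSpace ℝ (Fin 4)) (TangentSpace (𝓡 4) : Z → Type _))
      (cov : CovariantDerivative (𝓡 4) (EuclideanSpace ℝ (Fin 4)) (TangentSpace (𝓡 4) : Z → Type _))
      (U : Set Z) (T : Z → Z),
      (O : Set (Metric.sphere (0 : EuclideanSpace ℝ (Fin 5)) 1)) = {q}ᶜ → (∀ a, jC a ∈ O) →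
      Manifold.IsSmoothEmbedding (𝓡 4) (𝓡 4) ∞ e → (∀ (x : O) (a : C), x.1 = jC a → e x = kC a) →
      Manifold.IsSmoothEmbedding (𝓡∂ 4) (𝓡 4) ∞ kC →
      g.IsRiemannian → g.IsLeviCivita cov →
      (∀ (x : Z) (v w : TangentSpace (𝓡 4) x), g.curvatureForm cov x v w w v ≤ 0) →
      IsOpen U → (∀ z, kC (bC.incl z) ∈ U) → ContMDiffOn (𝓡 4) (𝓡 4) ∞ T U →
      (∀ x ∈ U, T x ∈ U) → (∀ x ∈ U, T (T x) = x) →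
      (∀ x ∈ U, (T x ∈ Set.range kC ↔ x ∈ Set.range kC)) →
      (∀ z, T (kC (bC.incl z)) = kC (bC.incl (τ z))) →
      (∀ x ∈ U, Literature.Geometry.Lorentzian.pullbackBilin (I := 𝓡 4) (I' := 𝓡 4) T g.val x = g.val x) →
      ∃ (P : Type) (_ : TopologicalSpace P) (_ : T2Space P) (_ : SecondCountableTopology P)
      (_ : ChartedSpace (EuclideanSpace ℝ (Fin 4)) P) (_ : IsManifold (𝓡 4) ∞ P) (_ : CompactSpace P)
      (_ : ConnectedSpace P),
      Literature.Topology.FourManifolds.IsConnectedSum (𝓡 4) (𝓡 4) (𝓡 4) Z Q P ∧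
      ∃ (γ : Literature.Geometry.Lorentzian.PseudoRiemannianMetric (𝓡 4) ∞ (EuclideanSpace ℝ (Fin 4)) (TangentSpace (𝓡 4) : P → Type _))
      (cov' : CovariantDerivative (𝓡 4) (EuclideanSpace ℝ (Fin 4)) (TangentSpace (𝓡 4) : P → Type _)),
      γ.IsRiemannian ∧ γ.IsLeviCivita cov' ∧
      ∀ (x : P) (v w : TangentSpace (𝓡 4) x), γ.curvatureForm cov' x v w w v ≤ 0) :
    ∀ (X : Type) [TopologicalSpace X] [T2Space X] [SecondCountableTopology X]
    [ChartedSpace (EuclideanSpace ℝ (Fin 4)) X] [IsManifold (𝓡 4) ∞ X] [CompactSpace X] [ConnectedSpace X]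
    (gX : Literature.Geometry.Lorentzian.PseudoRiemannianMetric (𝓡 4) ∞ (EuclideanSpace ℝ (Fin 4)) (TangentSpace (𝓡 4) : X → Type _)),
    gX.IsRiemannian → gX.HasConstantSectionalCurvature (-1) →
    ∀ S : Literature.Topology.FourManifolds.HomotopySphere 4,
    ∃ (Z P : Type) (_ : TopologicalSpace Z) (_ : T2Space Z) (_ : SecondCountableTopology Z)
    (_ : ChartedSpace (EuclideanSpace ℝ (Fin 4)) Z) (_ : IsManifold (𝓡 4) ∞ Z) (_ : CompactSpace Z)
    (_ : TopologicalSpace P) (_ : T2Space P) (_ : SecondCountableTopology P)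
    (_ : ChartedSpace (EuclideanSpace ℝ (Fin 4)) P) (_ : IsManifold (𝓡 4) ∞ P) (_ : CompactSpace P)
    (_ : ConnectedSpace P),
    (∃ c : Z → X, IsCoveringMap c ∧ Function.Surjective c ∧ IsLocalDiffeomorph (𝓡 4) (𝓡 4) ∞ c) ∧
    Literature.Topology.FourManifolds.IsConnectedSum (𝓡 4) (𝓡 4) (𝓡 4) Z S.carrier P ∧
    ∃ (g : Literature.Geometry.Lorentzian.PseudoRiemannianMetric (𝓡 4) ∞ (EuclideanSpace ℝ (Fin 4)) (TangentSpace (𝓡 4) : P → Type _))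
    (cov : CovariantDerivative (𝓡 4) (EuclideanSpace ℝ (Fin 4)) (TangentSpace (𝓡 4) : P → Type _)),
    g.IsRiemannian ∧ g.IsLeviCivita cov ∧
    ∀ (x : P) (X Y : TangentSpace (𝓡 4) x), g.curvatureForm cov x X Y Y X ≤ 0 := by
  intro X _ _ _ _ _ _ _ gX hgR hgC S
  -- stub 1: the cork presentation `S⁴ = C ∪_φ W`, `Σ = C ∪_(φ∘τ) W`, `τ` involutive
  obtain ⟨C, instTC, instT2C, instSCC, instChC, instMC, instCompC, instContrC, bC, W, instTW, instT2W,
    instSCW, instChW, instMW, instCompW, bW, φ, τ, hτ, hne, hS4, hSig⟩ := h1 S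
  obtain ⟨jC, jW, hjC, hjW, hcov, hseam⟩ := hS4
  -- stub 2: flatten along the embedded cork in a finite cover `Z` of `X`
  obtain ⟨Z, instTZ, instT2Z, instSCZ, instChZ, instMZ, instCompZ, instConnZ, c, q, O, e, kC, g, cov, U, T,
    hc, hO, hjO, he, hek, hkC, hgR', hLC, hsec, hU, hYU, hT, hTU, hTT, hside, hTτ, hiso⟩ :=
    h2 X gX hgR hgC C bC τ jC hτ hne hjC
  -- stub 3: reglue isometrically and identify the result with `Z # Σ`
  obtain ⟨P, instTP, instT2P, instSCP, instChP, instMP, instCompP, instConnP, hsum, γ, cov', hγ, hLC',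
    hsec'⟩ :=
    h3 C bC W bW φ τ jC jW hτ hne hjC hjW hcov hseam S.carrier hSig Z q O e kC g cov U T hO hjO he hek hkC
      hgR' hLC hsec hU hYU hT hTU hTT hside hTτ hiso
  exact ⟨Z, P, instTZ, instT2Z, instSCZ, instChZ, instMZ, instCompZ, instTP, instT2P, instSCP, instChP,
    instMP, instCompP, instConnP, ⟨c, hc⟩, hsum, γ, cov', hγ, hLC', hsec'⟩

/-- **THE SKELETON THEOREM: `CartanHadamardSwindle.FarrellJonesFour` BY NAME from the three declared stubs**
(`ledger skeleton check` shape: no hypotheses; `sorry` enters only through `stub_*`).  This is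
`farrellJonesFour_of_stubSigs stub_corkPresentation stub_corkFlattening stub_isometricCorkSum`, i.e. the
reading `stub_corkPresentation → stub_corkFlattening → stub_isometricCorkSum → FarrellJonesFour`. [folklore] -/
theorem FarrellJonesFour_of :
    Summit.SmoothPoincare4.SmoothPoincare4.Theses.CartanHadamardSwindle.FarrellJonesFour := by
  intro X _ _ _ _ _ _ _ gX hgR hgC S
  exact farrellJonesFour_of_stubSigs stub_corkPresentation stub_corkFlattening stub_isometricCorkSum
    X gX hgR hgC S

end Summit.SmoothPoincare4.SmoothPoincare4.Cruxes.FarrellJonesFour.Birth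

end
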